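import Mathlib
import Literature.AlgebraicGeometry.Resolution.CobordantChartCoefficients
import Literature.AlgebraicGeometry.Resolution.CobordantChartPlaneSlice
import Literature.AlgebraicGeometry.Resolution.CobordantTupleGame

/-!
# `WeightedInvariant.LocalWeightedDrop`, line `hasse-ridge-face-selection`: TRANSPORT OF THE `y`-FREE COEFFICIENTS
# OF A MONIC FORM UNDER THE CURVE BLOW-UP BRICK (the `A₁`-transport, part 2: curve chart)

Crux item stmt-ResolutionOfSingularities-8899 `LocalWeightedDrop` (route `ResolutionOfSingularities/WeightedInvariant`),
serving the door `WeightedConstruction` stmt-ResolutionOfSingularities-0571.  [OURS · L1 W4.3, chain w43, stub worker 2 (gen 2),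
CHAIN v2 seat table: the «A₁ transport» helper for the pieces S2s `stub_charTwoSeparableDoublePointWon` / S2i of skeleton v21.
Not a statement of any manuscript.]

In the move bricks `won_monic_of_pointBlowup` / `won_monic_of_curveBlowup` the coefficients `A_j(x') ∈ k[[x'_0, …, x'_{m-1}]]` of a
monic form `y^d + Σ_j A_j y^j` are replaced, at a singular successor, by
* POINT blow-up at the exceptional point `c`, live slot `i₀` (`c i₀ ≠ 0`): `A_j' = (s · B_j)|_{x'_{i₀} ↦ 0}` where
  `A_j ∘ chart(c) = s^{d-j+1} · B_j` (`chart(c) : x'_l ↦ s (c_l + x'_l)`, `TupleGame.slice i₀` kills `x'_{i₀}` and keeps `s = X 0`);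
* CURVE blow-up of `V(x'_i, y)` at `c_i ≠ 0`: `A_j' = c_i^{d-j} · (A'_j ∘ chart_{e_i}(c_i))|_{x'_i ↦ 0}` where `A_j = x_i'^{d-j} A'_j`.

This file treats the CURVE brick (the point brick is in the companion file `…CoeffTransportPoint.lean`; no definitions):
* `sliceCurveChart_eq` and its corollaries — the CURVE chart followed by the slice is the diagonal scaling `x'_i ↦ c_i x'_i`
  followed by the renaming `ρ : i ↦ 0, i.succAbove j ↦ j.succ`, hence injective (`sliceCurveChart_eq_zero_iff`,
  `C_mul_sliceCurveChart_eq_zero_iff`) and multiplicative, with `x'_i`-adic order carried to `s`-adic order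
  (`X_zero_dvd_sliceCurveChart_iff`, `sliceCurveChart_X_pow_mul`, `exists_curveCoeff_transport`).
-/

set_option linter.dupNamespace false -- mandated namespace of this single-conjunct summit

namespace Summit.ResolutionOfSingularities.ResolutionOfSingularities.Theorems

open Literature.AlgebraicGeometry.Resolution

namespace CoeffTransport

open MvPowerSeries

variable {k : Type} [Field k] {n : ℕ}

/-! ### The curve chart followed by the slice is a scaled renaming

Blow-up of `V(x'_i, y)` (weights `e_i` on the `x'`-space), exceptional point `(0,…,c_i,…,0)`, slice `x'_i ↦ 0`: the composite
substitution on `k[[x']]` is `x'_i ↦ c_i · s` (`s = X 0`) and `x'_l ↦ x''_{ρ l}` for `l ≠ i`, with the re-indexing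
`ρ : i ↦ 0`, `i.succAbove j ↦ j.succ` (a bijection).  We write it as the diagonal scaling `x'_i ↦ c_i x'_i` followed by `rename ρ`. -/

/-- The curve chart of `won_monic_of_curveBlowup` is substitutable. -/
theorem hasSubst_curveChart (i : Fin (n + 1)) (ci : k) :
    HasSubst (CobordantChart.chart (fun l : Fin (n + 1) => if l = i then 1 else 0) (fun l => if l = i then ci else 0)) :=
  CobordantChart.hasSubst_chart _ _ fun l hl => by
    by_cases h : l = i
    · simp [h] at hl
    · simp [h]

/-- The diagonal scaling `x'_i ↦ c_i x'_i` is substitutable. -/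
theorem hasSubst_scale (i : Fin (n + 1)) (ci : k) :
    HasSubst (fun l : Fin (n + 1) => if l = i then C ci * X l else (X l : MvPowerSeries (Fin (n + 1)) k)) :=
  hasSubst_of_constantCoeff_zero fun l => by
    split_ifs <;> simp [constantCoeff_X]

/-- The re-indexing `ρ` sends the blown-up slot `i` to the exceptional slot `0`. -/
theorem rho_apply_self (i : Fin (n + 1)) : ((finSuccEquiv' i).trans (finSuccEquiv n).symm) i = 0 := by
  simp

/-- The re-indexing `ρ` sends `i.succAbove j` to `j.succ`. -/
theorem rho_apply_succAbove (i : Fin (n + 1)) (j : Fin n) :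
    ((finSuccEquiv' i).trans (finSuccEquiv n).symm) (i.succAbove j) = j.succ := by
  simp

/-- Off the slot `i`, the slice's re-indexing `predAbove i ∘ succ` is `ρ`. -/
theorem predAbove_succ_eq_rho (i : Fin (n + 1)) (l : Fin (n + 1)) (hl : l ≠ i) :
    Fin.predAbove i l.succ = ((finSuccEquiv' i).trans (finSuccEquiv n).symm) l := by
  obtain ⟨j, rfl⟩ := Fin.exists_succAbove_eq hl
  rw [rho_apply_succAbove, ← Fin.succ_succAbove_succ, CobordantChartPlaneSlice.predAbove_succ_succAbove]

/-- THE SLICED CURVE CHART IS A SCALED RENAMING: `(G ∘ chart_{e_i}(c_i))|_{x'_i ↦ 0} = rename ρ (G(x'_i ↦ c_i x'_i))`. -/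
theorem sliceCurveChart_eq (i : Fin (n + 1)) (ci : k) (G : MvPowerSeries (Fin (n + 1)) k) :
    TupleGame.slice i (subst (CobordantChart.chart (fun l : Fin (n + 1) => if l = i then 1 else 0)
        (fun l => if l = i then ci else 0)) G) =
      rename ((finSuccEquiv' i).trans (finSuccEquiv n).symm)
        (subst (fun l : Fin (n + 1) => if l = i then C ci * X l else (X l : MvPowerSeries (Fin (n + 1)) k)) G) := by
  have hsl := CobordantChartPlaneSlice.hasSubst_slice (R := k) i
  have hX : HasSubst (X ∘ ⇑((finSuccEquiv' i).trans (finSuccEquiv n).symm) :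
      Fin (n + 1) → MvPowerSeries (Fin (n + 1)) k) := HasSubst.X_comp _
  unfold TupleGame.slice
  rw [subst_comp_subst_apply (hasSubst_curveChart i ci) hsl, rename_eq_subst, subst_comp_subst_apply (hasSubst_scale i ci) hX]
  congr 1
  funext l
  rw [CobordantChart.chart_apply]
  by_cases hl : l = i
  · rw [if_pos hl, if_pos hl, pow_one, ← coe_substAlgHom hsl, map_mul, map_add, coe_substAlgHom, subst_C,
      subst_X hsl, subst_X hsl, if_neg (Fin.succ_ne_zero _).symm, hl, if_pos rfl, Fin.predAbove_right_zero, add_zero,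
      if_pos rfl, ← coe_substAlgHom hX, map_mul, coe_substAlgHom, subst_C, subst_X hX, Function.comp_apply,
      rho_apply_self, mul_comm]
  · rw [if_neg hl, if_neg hl, pow_zero, one_mul, map_zero, zero_add, subst_X hsl,
      if_neg (fun h => hl (Fin.succ_injective _ h)), predAbove_succ_eq_rho i l hl, if_neg hl, subst_X hX,
      Function.comp_apply]

/-- COEFFICIENTS OF THE DIAGONAL SCALING: `coeff d (G(x'_i ↦ c_i x'_i)) = c_i^{d_i} · coeff d G`. -/
theorem coeff_subst_scale (i : Fin (n + 1)) (ci : k) (G : MvPowerSeries (Fin (n + 1)) k) (d : Fin (n + 1) →₀ ℕ) :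
    coeff d (subst (fun l : Fin (n + 1) => if l = i then C ci * X l else (X l : MvPowerSeries (Fin (n + 1)) k)) G) =
      ci ^ (d i) * coeff d G := by
  classical
  have hprod : ∀ e : Fin (n + 1) →₀ ℕ, (e.prod fun l m => (fun l : Fin (n + 1) => if l = i then C ci * X l
      else (X l : MvPowerSeries (Fin (n + 1)) k)) l ^ m) = monomial e (ci ^ (e i)) := by
    intro e
    rw [monomial_eq']
    simp only [Finsupp.prod]
    have hsplit : ∀ l : Fin (n + 1), (if l = i then C ci * X l else (X l : MvPowerSeries (Fin (n + 1)) k)) ^ (e l) =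
        C ((if l = i then ci else 1) ^ (e l)) * X l ^ (e l) := by
      intro l
      split_ifs with h
      · rw [mul_pow, map_pow]
      · rw [one_pow, map_one, one_mul]
    simp_rw [hsplit]
    rw [Finset.prod_mul_distrib, ← map_prod, Finset.prod_eq_single i (fun l _ hl => by rw [if_neg hl, one_pow])
      (fun hi => by rw [Finsupp.notMem_support_iff.mp hi, pow_zero]), if_pos rfl]
  rw [coeff_subst (hasSubst_scale i ci), finsum_eq_single _ d]
  · rw [hprod, coeff_monomial_same, smul_eq_mul, mul_comm]
  · intro e he
    rw [hprod, coeff_monomial_ne (Ne.symm he), smul_zero]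


/-- The diagonal scaling kills no non-zero series (`c_i ≠ 0`). -/
theorem subst_scale_eq_zero_iff (i : Fin (n + 1)) {ci : k} (hci : ci ≠ 0) (G : MvPowerSeries (Fin (n + 1)) k) :
    subst (fun l : Fin (n + 1) => if l = i then C ci * X l else (X l : MvPowerSeries (Fin (n + 1)) k)) G = 0 ↔ G = 0 := by
  refine ⟨fun h => ?_, fun h => by rw [h, ← coe_substAlgHom (hasSubst_scale i ci), map_zero]⟩
  ext d
  have hd := congrArg (coeff d) h
  rw [coeff_subst_scale, map_zero] at hd
  rw [map_zero]
  exact (mul_eq_zero.mp hd).resolve_left (pow_ne_zero _ hci)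

/-- `x'_i`-divisibility is unchanged by the diagonal scaling. -/
theorem X_dvd_subst_scale_iff (i : Fin (n + 1)) (ci : k) (G : MvPowerSeries (Fin (n + 1)) k) :
    X i ∣ subst (fun l : Fin (n + 1) => if l = i then C ci * X l else (X l : MvPowerSeries (Fin (n + 1)) k)) G ↔
      X i ∣ G := by
  rw [X_dvd_iff, X_dvd_iff]
  refine forall_congr' fun d => imp_congr_right fun hd => ?_
  rw [coeff_subst_scale, hd, pow_zero, one_mul]

/-- The diagonal scaling multiplies `x'_i^μ` by `c_i^μ`. -/
theorem subst_scale_X_pow_mul (i : Fin (n + 1)) (ci : k) (μ : ℕ) (H : MvPowerSeries (Fin (n + 1)) k) :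
    subst (fun l : Fin (n + 1) => if l = i then C ci * X l else (X l : MvPowerSeries (Fin (n + 1)) k)) (X i ^ μ * H) =
      C (ci ^ μ) * X i ^ μ *
        subst (fun l : Fin (n + 1) => if l = i then C ci * X l else (X l : MvPowerSeries (Fin (n + 1)) k)) H := by
  have hs := hasSubst_scale (k := k) i ci
  rw [← coe_substAlgHom hs, map_mul, map_pow, coe_substAlgHom, subst_X hs, if_pos rfl, mul_pow, map_pow]

/-- The renaming `ρ` is undone by `ρ⁻¹`. -/
theorem rename_rho_symm_rename_rho (i : Fin (n + 1)) (H : MvPowerSeries (Fin (n + 1)) k) :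
    rename ((finSuccEquiv' i).trans (finSuccEquiv n).symm).symm
      (rename ((finSuccEquiv' i).trans (finSuccEquiv n).symm) H) = H :=
  (renameEquiv k ((finSuccEquiv' i).trans (finSuccEquiv n).symm)).symm_apply_apply H

/-- The renaming `ρ` kills no non-zero series. -/
theorem rename_rho_eq_zero_iff (i : Fin (n + 1)) (H : MvPowerSeries (Fin (n + 1)) k) :
    rename ((finSuccEquiv' i).trans (finSuccEquiv n).symm) H = 0 ↔ H = 0 :=
  ⟨fun h => by rw [← rename_rho_symm_rename_rho i H, h, map_zero], fun h => by rw [h, map_zero]⟩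

/-- Under the renaming `ρ`, `x'_i`-divisibility becomes `s`-divisibility (`s = X 0`). -/
theorem X_zero_dvd_rename_rho_iff (i : Fin (n + 1)) (H : MvPowerSeries (Fin (n + 1)) k) :
    X 0 ∣ rename ((finSuccEquiv' i).trans (finSuccEquiv n).symm) H ↔ X i ∣ H := by
  have hρi : ((finSuccEquiv' i).trans (finSuccEquiv n).symm) i = 0 := rho_apply_self i
  have hρ0 : ((finSuccEquiv' i).trans (finSuccEquiv n).symm).symm 0 = i := by
    rw [Equiv.symm_apply_eq]; exact hρi.symm
  constructor
  · rintro ⟨Q, hQ⟩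
    refine ⟨rename ((finSuccEquiv' i).trans (finSuccEquiv n).symm).symm Q, ?_⟩
    have h := congrArg (rename (R := k) ⇑((finSuccEquiv' i).trans (finSuccEquiv n).symm).symm) hQ
    rw [rename_rho_symm_rename_rho, map_mul, rename_X, hρ0] at h
    exact h
  · rintro ⟨Q, rfl⟩
    exact ⟨rename ((finSuccEquiv' i).trans (finSuccEquiv n).symm) Q, by rw [map_mul, rename_X, hρi]⟩

/-- INJECTIVITY OF THE SLICED CURVE CHART (`c_i ≠ 0`): `(G ∘ chart_{e_i}(c_i))|_{x'_i ↦ 0} = 0 ↔ G = 0`.  In particular in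
`won_monic_of_curveBlowup` the new coefficient `c_i^{d-j} · (A'_j ∘ chart)|` vanishes iff `A'_j = 0`: the classes `{A₁ = 0}` /
`{A₁ ≠ 0}` of double points are closed under the curve blow-up brick as well. -/
theorem sliceCurveChart_eq_zero_iff (i : Fin (n + 1)) {ci : k} (hci : ci ≠ 0) (G : MvPowerSeries (Fin (n + 1)) k) :
    TupleGame.slice i (subst (CobordantChart.chart (fun l : Fin (n + 1) => if l = i then 1 else 0)
        (fun l => if l = i then ci else 0)) G) = 0 ↔ G = 0 := by
  rw [sliceCurveChart_eq, rename_rho_eq_zero_iff, subst_scale_eq_zero_iff i hci]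

/-- The bricks' coefficient `c_i^e · (G ∘ chart_{e_i}(c_i))|_{x'_i ↦ 0}` vanishes iff `G = 0` (`c_i ≠ 0`). -/
theorem C_mul_sliceCurveChart_eq_zero_iff (i : Fin (n + 1)) {ci : k} (hci : ci ≠ 0) (e : ℕ)
    (G : MvPowerSeries (Fin (n + 1)) k) :
    C (ci ^ e) * TupleGame.slice i (subst (CobordantChart.chart (fun l : Fin (n + 1) => if l = i then 1 else 0)
        (fun l => if l = i then ci else 0)) G) = 0 ↔ G = 0 := by
  rw [mul_eq_zero, sliceCurveChart_eq_zero_iff i hci, map_eq_zero_iff C C_injective]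
  simp [hci]

/-- `x'_i`-ADIC ORDER BECOMES `s`-ADIC ORDER under the sliced curve chart: `s ∣ (H ∘ chart)| ↔ x'_i ∣ H`. -/
theorem X_zero_dvd_sliceCurveChart_iff (i : Fin (n + 1)) (ci : k) (H : MvPowerSeries (Fin (n + 1)) k) :
    X 0 ∣ TupleGame.slice i (subst (CobordantChart.chart (fun l : Fin (n + 1) => if l = i then 1 else 0)
        (fun l => if l = i then ci else 0)) H) ↔ X i ∣ H := by
  rw [sliceCurveChart_eq, X_zero_dvd_rename_rho_iff, X_dvd_subst_scale_iff]

/-- The sliced curve chart sends `x'_i^μ · H` to `c_i^μ s^μ · (H ∘ chart)|`. -/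
theorem sliceCurveChart_X_pow_mul (i : Fin (n + 1)) (ci : k) (μ : ℕ) (H : MvPowerSeries (Fin (n + 1)) k) :
    TupleGame.slice i (subst (CobordantChart.chart (fun l : Fin (n + 1) => if l = i then 1 else 0)
        (fun l => if l = i then ci else 0)) (X i ^ μ * H)) =
      C (ci ^ μ) * X 0 ^ μ * TupleGame.slice i (subst (CobordantChart.chart
        (fun l : Fin (n + 1) => if l = i then 1 else 0) (fun l => if l = i then ci else 0)) H) := by
  rw [sliceCurveChart_eq, sliceCurveChart_eq, subst_scale_X_pow_mul, map_mul, map_mul, rename_C,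
    map_pow (rename _) (X i : MvPowerSeries (Fin (n + 1)) k) μ, rename_X, rho_apply_self]

/-- THE `A₁`-TRANSPORT UNDER THE CURVE BRICK.  If `A' = x'_i^μ · H` with `x'_i ∤ H` (so `μ` is the multiplicity of the component
`x'_i = 0` in `A' = 0`), then the new coefficient `c_i^e · (A' ∘ chart_{e_i}(c_i))|_{x'_i ↦ 0}` equals
`c_i^{e + μ} · s^μ · T` with `T = (H ∘ chart)|`, `s ∤ T` (and `T ≠ 0` when `H ≠ 0`, `c_i ≠ 0`). -/
theorem exists_curveCoeff_transport (i : Fin (n + 1)) {ci : k} (hci : ci ≠ 0) (e μ : ℕ)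
    {A' H : MvPowerSeries (Fin (n + 1)) k} (hA' : A' = X i ^ μ * H) (hH : ¬ X i ∣ H) :
    ∃ T : MvPowerSeries (Fin (n + 1)) k,
      C (ci ^ e) * TupleGame.slice i (subst (CobordantChart.chart (fun l : Fin (n + 1) => if l = i then 1 else 0)
        (fun l => if l = i then ci else 0)) A') = C (ci ^ (e + μ)) * X 0 ^ μ * T ∧ ¬ (X 0 ∣ T) ∧ T ≠ 0 := by
  refine ⟨TupleGame.slice i (subst (CobordantChart.chart (fun l : Fin (n + 1) => if l = i then 1 else 0)
    (fun l => if l = i then ci else 0)) H), ?_, ?_, ?_⟩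
  · rw [hA', sliceCurveChart_X_pow_mul, pow_add, map_mul]
    ring
  · rw [X_zero_dvd_sliceCurveChart_iff]
    exact hH
  · rw [Ne, sliceCurveChart_eq_zero_iff i hci]
    rintro rfl
    exact hH (dvd_zero _)

end CoeffTransport

end Summit.ResolutionOfSingularities.ResolutionOfSingularities.Theorems
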